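import Mathlib.NumberTheory.Zsqrtd.GaussianInt
import Mathlib.NumberTheory.Zsqrtd.QuadraticReciprocity
import Mathlib.NumberTheory.LegendreSymbol.JacobiSymbol
import Literature.NumberTheory.QuadraticFields.GaussianPrimary
import Literature.NumberTheory.QuadraticFields.JacobiCharacter
import Literature.NumberTheory.LFunctions.GaussianHeckeMeanValue
import HarnessLib

/-!
# Friedlander–Iwaniec, *The polynomial `X² + Y⁴` captures its primes*, §19: the Dirichlet symbol `(z / w)` on `ℤ[i]`

Family `parity`, statement parity.S17 (`setOf_prime_sq_add_pow_four_infinite`). Source: J. Friedlander,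
H. Iwaniec, Ann. of Math. (2) 148 (1998), 945–1040 [FriedlanderIwaniecAnnals1998], §19 "Real characters
in the Gaussian domain", (19.1)–(19.12) (arXiv math/9811185, pp. 70–71).

Sections 19–26 of the source form a unit that is independent of §§2–18 ("We still need to prove
Proposition 17.2. We postpone this task to establish first a larger background so as to be able to
include a proof of the more general Theorem 2^ψ stated in Section 26. This itself does not depend on
the results already established", §18, p. 70): real characters on `ℤ[i]` (§19), the Jacobi–Kubota
symbol `[z]` and its twisted multiplicativity (§20, Lemma 20.1), bilinear and linear forms in
Dirichlet and Jacobi–Kubota symbols (§§21–22, Props 21.3, 21.4, 22.1), quadratic eigenvalues (§23,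
Props 23.1, 23.2), combinatorial identities (§24, Prop 24.2), and the assembly of Proposition 17.2 and
Theorem 2^ψ (§§25–26) — the estimate for `W(β)`, the third part of the main term of Proposition 4.1
(`FriedlanderIwaniec1998_prop41`, the tree's one cited fact for FI §§4–26). This file opens that
unit with §19. Everything here is PROVED; there is one definition (`dirichletSym`) and no named
facts; the predicate "`z` primitive" is the tree's `Literature.NumberTheory.LFunctions.GaussianInt.IsPrimitive`.

## Contents

* `isPrimitive_iff` (`(re z, im z) = 1`, the tree's `IsPrimitive`, §5: "`z` is primitive");
  `not_natCast_dvd_of_isPrimitive`.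
* `dirichletSym z w = ((Re wz) / |w|²)` (Jacobi symbol) — **the Dirichlet symbol** `(z/w) = ξ_w(z)` of
  (19.10)–(19.11), with the coordinate form (19.9) `dirichletSym_eq`. It is used, as in the source,
  for `w` primary (`GaussianPrimary.IsPrimary`, Ireland–Rosen's `w ≡ 1 (mod 2+2i)` = the source's
  (5.3)) and primitive.
* `jacobiSym_re_natAbs_norm` — **(19.8)** `(u / q) = 1` for `w = u + iv` primary primitive, `q = |w|²`
  (`(u/q) = (|u|/q) = (q/|u|) = (v²/|u|) = 1`, by reciprocity as `q ≡ 1 (mod 4)`).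
* `dirichletSym_intCast` — **(19.3)** `(n / w) = (n / q)` on `ℤ`; `dirichletSym_one`,
  `dirichletSym_neg_one` — **(19.4)** `ξ_w(±1) = 1`; `dirichletSym_add_natAbs_norm_mul`,
  `dirichletSym_eq_of_dvd_sub` — periodicity modulo `q`.
* `exists_ringHom_dirichletSym_eq` — **(19.2)/(19.7)/(19.9)**: there is a ring homomorphism
  `φ : ℤ[i] → ℤ/qℤ` (`r + is ↦ r + ω s`, `ω = -v ū`, `ω² ≡ -1`) with `(z / w) = χ_q(φ z)`, `χ_q` the
  Jacobi character; `exists_int_dirichletSym_eq` — the same with an integer root `ω` of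
  `ω² + 1 ≡ 0 (mod q)`: `(z / w) = ((r + ω s) / q)`; hence `dirichletSym_mul_left` — **complete
  multiplicativity in `z`** ("`ξ` is periodic of period `q`, and it is multiplicative as well");
  `dirichletSym_trichotomy` (values `0, ±1`).
* `natCast_dvd_norm_of_prime_dvd_mul` — an odd rational prime dividing `wz`, `w`, `z` primitive,
  splits as `π π̄` with `π ∣ w`, `π̄ ∣ z` (or conversely), so it divides `|w|²` and `|z|²`;
  `dirichletSym_comm` — **the reciprocity law (19.12)** `(z / w) = (w / z)` for `w`, `z` primary
  primitive (if `wz` is primitive, `(z/w)(w/z) = (Re wz / |wz|²) = 1` by (19.8); otherwise both sides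
  vanish); `dirichletSym_eq_zero_of_dvd` — `(w, z̄) ≠ 1 ⇒ (z / w) = 0`.

Not here (not needed downstream in the form printed): (19.5) (the value at `±i`), the converse of the
vanishing criterion, the lower-entry multiplicativity (19.13)–(19.15) and the `L`-function (19.16)–(19.17)
("We shall not use any property of `L(s, ξ)` in this paper").

## References

* J. Friedlander, H. Iwaniec, *The polynomial `X² + Y⁴` captures its primes*, Ann. of Math. (2) 148
  (1998), 945–1040, §19, (19.1)–(19.12). [FriedlanderIwaniecAnnals1998]
* P. G. L. Dirichlet, J. Reine Angew. Math. 9 (1832), 379–389 (the case `|w|²` prime; cited as [Di]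
  in the source).

## Tree / Mathlib

Tree: `LFunctions.GaussianInt.IsPrimitive` (`GaussianHeckeMeanValue`); `GaussianPrimary.IsPrimary`
(+ `.mul`, `.ne_zero`), `exists_isPrimary_norm_eq`,
`prime_of_norm_eq_prime`, `not_dvd_star_of_norm_eq_prime`, `natCast_eq_mul_star`, `norm_dvd_norm`,
`cast_norm_eq` (`QuadraticFields/GaussianPrimary`); `jacobiChar`, `jacobiChar_apply`
(`QuadraticFields/JacobiCharacter`). Mathlib: `jacobiSym` (`mul_left`, `mul_right'`, `mod_left'`,
`sq_one'`, `neg`, `at_neg_one`, `eq_zero_iff_not_coprime`, `quadratic_reciprocity_one_mod_four'`,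
`trichotomy`), `ZMod.χ₄_nat_one_mod_four`, `Zsqrtd.lift`, `Zsqrtd.decompose`, `Zsqrtd.intCast_dvd`,
`GaussianInt.prime_of_nat_prime_of_mod_four_eq_three`, `Irreducible.coprime_iff_not_dvd`,
`WfDvdMonoid.exists_irreducible_factor`, `ZMod.coe_int_isUnit_iff_isCoprime`.
-/

noncomputable section

open Zsqrtd GaussianInt
open scoped NumberTheorySymbols

namespace Literature.NumberTheory.Sieve.FriedlanderIwaniecPrimes

open Literature.NumberTheory.QuadraticFields Literature.NumberTheory.QuadraticFields.GaussianPrimary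

local notation "ℤ[i]" => GaussianInt

/-! ### Primitive Gaussian integers

A Gaussian integer `z = r + is` is *primitive* if `(r, s) = 1` (Friedlander–Iwaniec, §5: "`|z|² = r² + s²`
squarefree, which implies `(r, s) = 1` so `z` is primitive"). We REUSE the tree's predicate
`Literature.NumberTheory.LFunctions.GaussianInt.IsPrimitive` (`GaussianHeckeMeanValue.lean`, Harman's
"`n = x + iy`, `(x, y) = 1`"), opened below, rather than redefining it. -/

open Literature.NumberTheory.LFunctions.GaussianInt (IsPrimitive)

/-- Unfolding `IsPrimitive` (the tree's `Literature.NumberTheory.LFunctions.GaussianInt.IsPrimitive`):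
`(re z, im z) = 1`. [cite: FriedlanderIwaniecAnnals1998, §5 after (5.13)] -/
theorem isPrimitive_iff (z : ℤ[i]) : IsPrimitive z ↔ Int.gcd z.re z.im = 1 := Iff.rfl

/-! ### The Dirichlet symbol -/

/-- **The Dirichlet symbol** `(z / w) = ((Re w z) / |w|²)` (a Jacobi symbol; Friedlander–Iwaniec
(19.10)–(19.11): "`ξ_w(z) = (Re wz / |w|²)` … we call this the Dirichlet symbol even when `w` is not
prime"; it is used only for `w` primary and primitive). For `w = u + iv`, `z = r + is` this is
`((ur - vs) / (u² + v²))` (19.9). [cite: FriedlanderIwaniecAnnals1998, (19.10)–(19.11)] -/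
def dirichletSym (z w : ℤ[i]) : ℤ := J((w * z).re | w.norm.natAbs)

/-- Unfolding `dirichletSym`. [cite: FriedlanderIwaniecAnnals1998, (19.10)] -/
theorem dirichletSym_def (z w : ℤ[i]) : dirichletSym z w = J((w * z).re | w.norm.natAbs) := rfl

/-- (19.9): for `w = u + iv`, `z = r + is`, `(z / w) = ((ur - vs) / (u² + v²))`.
[cite: FriedlanderIwaniecAnnals1998, (19.9)–(19.10)] -/
theorem dirichletSym_eq (z w : ℤ[i]) :
    dirichletSym z w = J(w.re * z.re - w.im * z.im | w.norm.natAbs) := by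
  rw [dirichletSym_def, Zsqrtd.re_mul]
  congr 1
  ring

/-! ### Norms of primary / primitive Gaussian integers -/

/-- `|w|² = u² + v²` as a natural number. [folklore] -/
theorem natAbs_norm_eq_sq_add_sq (w : ℤ[i]) :
    (w.norm.natAbs : ℤ) = w.re ^ 2 + w.im ^ 2 := by
  rw [GaussianInt.abs_natCast_norm, Zsqrtd.norm_def]; ring

/-- A primary `w = u + iv` has `u` odd and `v` even, hence `|w|² ≡ 1 (mod 4)`. [folklore] -/
theorem natAbs_norm_mod_four_of_isPrimary {w : ℤ[i]} (hw : IsPrimary w) :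
    w.norm.natAbs % 4 = 1 := by
  have h : ((w.norm.natAbs : ℕ) : ℤ) % 4 = 1 := by
    rw [natAbs_norm_eq_sq_add_sq]
    rcases hw with ⟨h1, h2⟩ | ⟨h1, h2⟩
    · have e1 : w.re = 4 * (w.re / 4) + 1 := by omega
      have e2 : w.im = 4 * (w.im / 4) := by omega
      rw [e1, e2]; ring_nf; omega
    · have e1 : w.re = 4 * (w.re / 4) + 3 := by omega
      have e2 : w.im = 4 * (w.im / 4) + 2 := by omega
      rw [e1, e2]; ring_nf; omega
  omega

/-- A primary Gaussian integer has odd norm. [folklore] -/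
theorem odd_natAbs_norm_of_isPrimary {w : ℤ[i]} (hw : IsPrimary w) : Odd w.norm.natAbs :=
  Nat.odd_iff.mpr (by have := natAbs_norm_mod_four_of_isPrimary hw; omega)

/-- A primary Gaussian integer has odd real part. [folklore] -/
theorem re_odd_of_isPrimary {w : ℤ[i]} (hw : IsPrimary w) : w.re % 2 = 1 := by
  rcases hw with ⟨h1, -⟩ | ⟨h1, -⟩ <;> omega

/-- For `w = u + iv` primitive, `(u, |w|²) = 1`. [folklore] -/
theorem gcd_re_natAbs_norm_of_isPrimitive {w : ℤ[i]} (hw : IsPrimitive w) :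
    Int.gcd w.re w.norm.natAbs = 1 := by
  rw [isPrimitive_iff] at hw
  have h1 : IsCoprime w.re w.im := Int.isCoprime_iff_gcd_eq_one.mpr hw
  have h2 : IsCoprime w.re (w.im ^ 2 + w.re * w.re) := (h1.pow_right (n := 2)).add_mul_left_right w.re
  have h3 : IsCoprime w.re (w.norm.natAbs : ℤ) := by
    rw [natAbs_norm_eq_sq_add_sq]
    convert h2 using 1; ring
  exact Int.isCoprime_iff_gcd_eq_one.mp h3

/-- `Int.gcd` against a `natAbs` cast. [folklore] -/
theorem int_gcd_natAbs_cast (x y : ℤ) : Int.gcd x (y.natAbs : ℤ) = Int.gcd x y := by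
  rw [Int.gcd_eq_natAbs, Int.gcd_eq_natAbs, Int.natAbs_natCast]

/-- **(19.8)**: for `w = u + iv` primary and primitive, `(u / |w|²) = 1` ("since
`(u/q) = (|u|/q) = (q/|u|) = (v²/|u|) = 1`"). [cite: FriedlanderIwaniecAnnals1998, (19.8)] -/
theorem jacobiSym_re_natAbs_norm {w : ℤ[i]} (hw : IsPrimary w) (hw' : IsPrimitive w) :
    J(w.re | w.norm.natAbs) = 1 := by
  have hq4 : w.norm.natAbs % 4 = 1 := natAbs_norm_mod_four_of_isPrimary hw
  have hqodd : Odd w.norm.natAbs := Nat.odd_iff.mpr (by omega)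
  have haodd : Odd w.re.natAbs := by
    rw [Int.natAbs_odd, Int.odd_iff]; exact re_odd_of_isPrimary hw
  -- `(u / q) = (|u| / q)`
  have h1 : J(w.re | w.norm.natAbs) = J((w.re.natAbs : ℤ) | w.norm.natAbs) := by
    rcases Int.natAbs_eq w.re with h | h
    · exact congrArg (J(· | w.norm.natAbs)) h
    · conv_lhs => rw [h]
      rw [jacobiSym.neg _ hqodd, ZMod.χ₄_nat_one_mod_four hq4, one_mul]
  -- `(|u| / q) = (q / |u|) = (v² / |u|) = 1`
  have h2 : J((w.re.natAbs : ℤ) | w.norm.natAbs) = J((w.norm.natAbs : ℤ) | w.re.natAbs) :=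
    jacobiSym.quadratic_reciprocity_one_mod_four' haodd hq4
  have h3 : J((w.norm.natAbs : ℤ) | w.re.natAbs) = J(w.im ^ 2 | w.re.natAbs) := by
    refine jacobiSym.mod_left' ?_
    obtain ⟨k, hk⟩ : (w.re.natAbs : ℤ) ∣ w.re ^ 2 := by
      rw [sq]; exact (Int.natAbs_dvd.mpr dvd_rfl).mul_right _
    have hqz : (w.norm.natAbs : ℤ) = w.im ^ 2 + (w.re.natAbs : ℤ) * k := by
      rw [natAbs_norm_eq_sq_add_sq, hk]; ring
    rw [hqz, Int.add_mul_emod_self_left]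
  have h4 : J(w.im ^ 2 | w.re.natAbs) = 1 := by
    refine jacobiSym.sq_one' ?_
    rw [int_gcd_natAbs_cast, Int.gcd_comm]
    exact hw'
  rw [h1, h2, h3, h4]

/-! ### Elementary values and periodicity -/

/-- **(19.3)**: on rational integers the Dirichlet symbol is the Jacobi symbol, `(n / w) = (n / |w|²)`,
for `w` primary primitive. [cite: FriedlanderIwaniecAnnals1998, (19.3)] -/
theorem dirichletSym_intCast {w : ℤ[i]} (hw : IsPrimary w) (hw' : IsPrimitive w) (n : ℤ) :
    dirichletSym (n : ℤ[i]) w = J(n | w.norm.natAbs) := by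
  rw [dirichletSym_def]
  have : (w * (n : ℤ[i])).re = w.re * n := by simp [Zsqrtd.re_mul]
  rw [this, jacobiSym.mul_left, jacobiSym_re_natAbs_norm hw hw', one_mul]

/-- `(1 / w) = 1` for `w` primary primitive ((19.4)). [cite: FriedlanderIwaniecAnnals1998, (19.4)] -/
theorem dirichletSym_one {w : ℤ[i]} (hw : IsPrimary w) (hw' : IsPrimitive w) :
    dirichletSym 1 w = 1 := by
  have := dirichletSym_intCast hw hw' 1
  rw [Int.cast_one] at this
  rw [this, jacobiSym.one_left]

/-- **(19.4)**: `(-1 / w) = 1` for `w` primary primitive (`|w|² ≡ 1 (mod 4)`); so `ξ_w` is even.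
[cite: FriedlanderIwaniecAnnals1998, (19.4)] -/
theorem dirichletSym_neg_one {w : ℤ[i]} (hw : IsPrimary w) (hw' : IsPrimitive w) :
    dirichletSym (-1) w = 1 := by
  have := dirichletSym_intCast hw hw' (-1)
  rw [Int.cast_neg, Int.cast_one] at this
  rw [this, jacobiSym.at_neg_one (odd_natAbs_norm_of_isPrimary hw),
    ZMod.χ₄_nat_one_mod_four (natAbs_norm_mod_four_of_isPrimary hw)]

/-- The Dirichlet symbol is periodic in `z` modulo `q = |w|²` ("Clearly `ξ` is periodic of period
`q`"). [cite: FriedlanderIwaniecAnnals1998, §19 after (19.2)] -/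
theorem dirichletSym_add_natAbs_norm_mul (z t w : ℤ[i]) :
    dirichletSym (z + (w.norm.natAbs : ℤ[i]) * t) w = dirichletSym z w := by
  rw [dirichletSym_def, dirichletSym_def]
  refine jacobiSym.mod_left' ?_
  have : (w * (z + (w.norm.natAbs : ℤ[i]) * t)).re = (w * z).re + (w.norm.natAbs : ℤ) * (w * t).re := by
    simp only [mul_add, Zsqrtd.re_add, Zsqrtd.re_mul, Zsqrtd.re_natCast, Zsqrtd.im_natCast,
      Zsqrtd.re_mul, zero_mul, Zsqrtd.im_mul, add_zero, mul_zero]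
    ring
  rw [this, Int.add_mul_emod_self_left]

/-- Congruent arguments modulo `|w|²` have the same symbol. [cite: FriedlanderIwaniecAnnals1998, §19 after (19.2)] -/
theorem dirichletSym_eq_of_dvd_sub {z z' w : ℤ[i]} (h : (w.norm.natAbs : ℤ[i]) ∣ z - z') :
    dirichletSym z w = dirichletSym z' w := by
  obtain ⟨t, ht⟩ := h
  have : z = z' + (w.norm.natAbs : ℤ[i]) * t := by rw [← ht]; ring
  rw [this, dirichletSym_add_natAbs_norm_mul]

/-! ### The symbol as a character: `ξ_w = χ_q ∘ (r + is ↦ r + ω s)` -/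

/-- The Jacobi symbol of the canonical representative of `a : ZMod q` depends only on `a`:
for an integer `n`, `(((n : ZMod q).val) / q) = (n / q)`. [folklore] -/
theorem jacobiSym_val_intCast (n : ℤ) (q : ℕ) [NeZero q] :
    J((((n : ZMod q).val : ℕ) : ℤ) | q) = J(n | q) := by
  rw [ZMod.val_intCast, ← jacobiSym.mod_left]

/-- The `ℤ`-valued Jacobi character on `ZMod q` is multiplicative (from the tree's bundled
`jacobiChar q`). [folklore] -/
theorem jacobiSym_val_mul (q : ℕ) [NeZero q] (a b : ZMod q) :
    J(((a * b).val : ℤ) | q) = J((a.val : ℤ) | q) * J((b.val : ℤ) | q) := by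
  have h := map_mul (jacobiChar q) a b
  rw [jacobiChar_apply, jacobiChar_apply, jacobiChar_apply] at h
  exact_mod_cast h

/-- **(19.2) ⇔ (19.9)–(19.10)**: for `w = u + iv` primary primitive with `q = |w|²` there is a root
`ω` of `ω² + 1 ≡ 0 (mod q)` (namely `ω ≡ -v ū`, (19.7)) such that
`(z / w) = ((r + ω s) / q)` for all `z = r + is`; i.e. the Dirichlet symbol is the Jacobi character
`χ_q` composed with the ring homomorphism `ℤ[i] → ℤ/qℤ`, `r + is ↦ r + ω s`.
[cite: FriedlanderIwaniecAnnals1998, (19.2), (19.7), (19.9)] -/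
theorem exists_ringHom_dirichletSym_eq {w : ℤ[i]} (hw : IsPrimary w) (hw' : IsPrimitive w) :
    ∃ φ : ℤ[i] →+* ZMod w.norm.natAbs,
      ∀ z : ℤ[i], dirichletSym z w = J(((φ z).val : ℤ) | w.norm.natAbs) := by
  set q : ℕ := w.norm.natAbs with hq
  have hqodd : Odd q := odd_natAbs_norm_of_isPrimary hw
  haveI : NeZero q := ⟨hqodd.pos.ne'⟩
  -- `u` is a unit mod `q`
  have hu : IsUnit (w.re : ZMod q) := by
    rw [ZMod.coe_int_isUnit_iff_isCoprime]
    refine Int.isCoprime_iff_gcd_eq_one.mpr ?_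
    rw [Int.gcd_comm, hq]
    exact gcd_re_natAbs_norm_of_isPrimitive hw'
  obtain ⟨uu, huu⟩ := hu
  -- `u² + v² = 0` in `ZMod q`
  have hsum : (w.re : ZMod q) ^ 2 + (w.im : ZMod q) ^ 2 = 0 := by
    have h1 : ((w.norm.natAbs : ℤ) : ZMod q) = 0 := by
      rw [Int.cast_natCast, hq, ZMod.natCast_self]
    rw [natAbs_norm_eq_sq_add_sq] at h1
    push_cast at h1
    exact h1
  -- the root `ω = -v u⁻¹`
  set ω : ZMod q := -(w.im : ZMod q) * (uu⁻¹ : (ZMod q)ˣ) with hω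
  have hωsq : ω * ω = ((-1 : ℤ) : ZMod q) := by
    rw [Int.cast_neg, Int.cast_one, hω]
    have h2 : (w.im : ZMod q) ^ 2 = -(w.re : ZMod q) ^ 2 := eq_neg_of_add_eq_zero_right hsum
    calc -(w.im : ZMod q) * (uu⁻¹ : (ZMod q)ˣ) * (-(w.im : ZMod q) * (uu⁻¹ : (ZMod q)ˣ))
        = (w.im : ZMod q) ^ 2 * ((uu⁻¹ : (ZMod q)ˣ) : ZMod q) ^ 2 := by ring
      _ = -((w.re : ZMod q) * ((uu⁻¹ : (ZMod q)ˣ) : ZMod q)) ^ 2 := by rw [h2]; ring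
      _ = -1 := by rw [← huu, Units.mul_inv, one_pow]
  refine ⟨Zsqrtd.lift ⟨ω, hωsq⟩, fun z => ?_⟩
  -- `u (r + ω s) = ur - vs = Re(wz)` in `ZMod q`
  have hkey : ((w * z).re : ZMod q) = (w.re : ZMod q) * Zsqrtd.lift ⟨ω, hωsq⟩ z := by
    rw [Zsqrtd.lift_apply_apply, Zsqrtd.re_mul]
    push_cast
    rw [hω, ← huu]
    have : (uu : ZMod q) * ((z.re : ZMod q) + (z.im : ZMod q) * (-(w.im : ZMod q) * (uu⁻¹ : (ZMod q)ˣ)))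
        = (uu : ZMod q) * z.re - w.im * z.im * ((uu : ZMod q) * (uu⁻¹ : (ZMod q)ˣ)) := by ring
    rw [this, Units.mul_inv, mul_one]
    ring
  -- compare the two Jacobi symbols through `jacobiChar q`
  rw [dirichletSym_def, ← hq, ← jacobiSym_val_intCast (w * z).re q, hkey, jacobiSym_val_mul]
  have h1 : J((((w.re : ℤ) : ZMod q).val : ℤ) | q) = 1 := by
    rw [jacobiSym_val_intCast, hq, jacobiSym_re_natAbs_norm hw hw']
  rw [h1, one_mul]

/-- **(19.2), integer form**: for `w` primary primitive with `q = |w|²` there is an integer `ω` with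
`ω² + 1 ≡ 0 (mod q)` and `(z / w) = ((r + ω s) / q)` for every `z = r + is`.
[cite: FriedlanderIwaniecAnnals1998, (19.1)–(19.2)] -/
theorem exists_int_dirichletSym_eq {w : ℤ[i]} (hw : IsPrimary w) (hw' : IsPrimitive w) :
    ∃ ω : ℤ, (w.norm.natAbs : ℤ) ∣ ω ^ 2 + 1 ∧
      ∀ z : ℤ[i], dirichletSym z w = J(z.re + ω * z.im | w.norm.natAbs) := by
  haveI : NeZero w.norm.natAbs := ⟨(odd_natAbs_norm_of_isPrimary hw).pos.ne'⟩
  obtain ⟨φ, hφ⟩ := exists_ringHom_dirichletSym_eq hw hw'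
  refine ⟨((φ Zsqrtd.sqrtd).val : ℤ), ?_, fun z => ?_⟩
  · rw [← ZMod.intCast_zmod_eq_zero_iff_dvd]
    push_cast
    rw [ZMod.natCast_zmod_val, sq, ← map_mul, Zsqrtd.dmuld]
    simp
  · have hz : z = (z.re : ℤ[i]) + Zsqrtd.sqrtd * (z.im : ℤ[i]) := by
      obtain ⟨r, s⟩ := z
      exact Zsqrtd.decompose
    have hφz : φ z = ((z.re + ((φ Zsqrtd.sqrtd).val : ℤ) * z.im : ℤ) : ZMod w.norm.natAbs) := by
      conv_lhs => rw [hz]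
      push_cast
      rw [map_add, map_mul, map_intCast, map_intCast, ZMod.natCast_zmod_val, mul_comm]
    rw [hφ z, hφz, jacobiSym_val_intCast]

/-- **The Dirichlet symbol is completely multiplicative in `z`** for `w` primary primitive
("Clearly `ξ` is periodic of period `q`, and it is multiplicative as well").
[cite: FriedlanderIwaniecAnnals1998, §19 after (19.2)] -/
theorem dirichletSym_mul_left {w : ℤ[i]} (hw : IsPrimary w) (hw' : IsPrimitive w) (z₁ z₂ : ℤ[i]) :
    dirichletSym (z₁ * z₂) w = dirichletSym z₁ w * dirichletSym z₂ w := by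
  obtain ⟨φ, hφ⟩ := exists_ringHom_dirichletSym_eq hw hw'
  haveI : NeZero w.norm.natAbs := ⟨(odd_natAbs_norm_of_isPrimary hw).pos.ne'⟩
  rw [hφ, hφ, hφ, map_mul, jacobiSym_val_mul]

/-- The values of the Dirichlet symbol are `0, 1, -1`. [cite: FriedlanderIwaniecAnnals1998, (19.10)] -/
theorem dirichletSym_trichotomy (z w : ℤ[i]) :
    dirichletSym z w = 0 ∨ dirichletSym z w = 1 ∨ dirichletSym z w = -1 :=
  jacobiSym.trichotomy _ _

/-! ### Primitivity and rational prime divisors -/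

/-- A primitive Gaussian integer has no rational integer divisor `n > 1`. [folklore] -/
theorem not_natCast_dvd_of_isPrimitive {w : ℤ[i]} (hw : IsPrimitive w) {n : ℕ} (hn : 1 < n) :
    ¬ (n : ℤ[i]) ∣ w := by
  intro h
  rw [← Int.cast_natCast, Zsqrtd.intCast_dvd] at h
  have h1 : (n : ℤ) ∣ (Int.gcd w.re w.im : ℤ) := Int.dvd_coe_gcd h.1 h.2
  rw [hw, Nat.cast_one] at h1
  have : (n : ℤ) ≤ 1 := Int.le_of_dvd one_pos h1
  omega

/-- **Odd rational primes dividing a product of primitive Gaussian integers**: if `p ∣ wz` in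
`ℤ[i]` with `p` an odd rational prime and `w`, `z` primitive, then `p` splits, `p = π π̄` with
`π ∣ w`, `π̄ ∣ z` (or conversely), so `p ∣ |w|²` and `p ∣ |z|²` (an inert `p` is a Gaussian prime and
would divide `w` or `z`). [cite: FriedlanderIwaniecAnnals1998, §19, proof of (19.12)] -/
theorem natCast_dvd_norm_of_prime_dvd_mul {p : ℕ} (hp : p.Prime) (hp2 : p ≠ 2) {w z : ℤ[i]}
    (hw : IsPrimitive w) (hz : IsPrimitive z) (h : (p : ℤ[i]) ∣ w * z) :
    (p : ℤ) ∣ w.norm ∧ (p : ℤ) ∣ z.norm := by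
  haveI := Fact.mk hp
  have hp4 : p % 4 = 1 ∨ p % 4 = 3 := by
    rcases hp.eq_two_or_odd with h2 | h2
    · exact absurd h2 hp2
    · omega
  rcases hp4 with hp1 | hp3
  · -- split prime: `p = π π̄`
    obtain ⟨π, -, hπn⟩ := exists_isPrimary_norm_eq hp1
    have hπ : Prime π := prime_of_norm_eq_prime hp hπn
    have hσn : (star π).norm = p := by rw [Zsqrtd.norm_conj, hπn]
    have hσ : Prime (star π) := prime_of_norm_eq_prime hp hσn
    have hpe : (p : ℤ[i]) = π * star π := natCast_eq_mul_star hπn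
    have hcop : IsCoprime π (star π) :=
      (Irreducible.coprime_iff_not_dvd hπ.irreducible).mpr (not_dvd_star_of_norm_eq_prime hp hp1 hπn)
    rw [hpe] at h
    have h1 : π ∣ w ∨ π ∣ z := hπ.dvd_or_dvd ((dvd_mul_right π (star π)).trans h)
    have h2 : star π ∣ w ∨ star π ∣ z := hσ.dvd_or_dvd ((dvd_mul_left (star π) π).trans h)
    have hboth : ∀ x : ℤ[i], IsPrimitive x → π ∣ x → star π ∣ x → False := by
      intro x hx hx1 hx2
      have : (p : ℤ[i]) ∣ x := hpe ▸ hcop.mul_dvd hx1 hx2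
      exact not_natCast_dvd_of_isPrimitive hx hp.one_lt this
    rcases h1 with h1 | h1 <;> rcases h2 with h2 | h2
    · exact (hboth w hw h1 h2).elim
    · exact ⟨hπn ▸ norm_dvd_norm h1, hσn ▸ norm_dvd_norm h2⟩
    · exact ⟨hσn ▸ norm_dvd_norm h2, hπn ▸ norm_dvd_norm h1⟩
    · exact (hboth z hz h1 h2).elim
  · -- inert prime: impossible
    have hpp : Prime (p : ℤ[i]) := GaussianInt.prime_of_nat_prime_of_mod_four_eq_three p hp3
    rcases hpp.dvd_or_dvd h with h1 | h1
    · exact (not_natCast_dvd_of_isPrimitive hw hp.one_lt h1).elim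
    · exact (not_natCast_dvd_of_isPrimitive hz hp.one_lt h1).elim

/-- A Jacobi symbol `(a / b)` vanishes when a prime divides both entries. [folklore] -/
theorem jacobiSym_eq_zero_of_prime_dvd {p : ℕ} (hp : p.Prime) {a : ℤ} {b : ℕ} (hb : b ≠ 0)
    (ha : (p : ℤ) ∣ a) (hpb : (p : ℤ) ∣ b) : J(a | b) = 0 := by
  haveI : NeZero b := ⟨hb⟩
  rw [jacobiSym.eq_zero_iff_not_coprime]
  intro hg
  have h1 : (p : ℤ) ∣ (Int.gcd a b : ℤ) := Int.dvd_coe_gcd ha hpb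
  rw [hg, Nat.cast_one] at h1
  have : (p : ℤ) ≤ 1 := Int.le_of_dvd one_pos h1
  have := hp.one_lt
  omega

/-! ### The reciprocity law (19.12) -/

/-- **Reciprocity for the Dirichlet symbol (19.12)**: if both `w` and `z` are primary primitive then
`(z / w) = (w / z)` ("Indeed, if `wz` is primitive then by (19.8)
`(z/w)(w/z) = (Re wz / |wz|²) = 1` … whereas if not then `(w, z̄) ≠ 1` in which case both sides of
(19.12) vanish"). [cite: FriedlanderIwaniecAnnals1998, (19.12)] -/
theorem dirichletSym_comm {w z : ℤ[i]} (hw : IsPrimary w) (hw' : IsPrimitive w)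
    (hz : IsPrimary z) (hz' : IsPrimitive z) : dirichletSym z w = dirichletSym w z := by
  have hwz : IsPrimary (w * z) := hw.mul hz
  have hre : (z * w).re = (w * z).re := by rw [mul_comm]
  have hw0 : w.norm.natAbs ≠ 0 := (odd_natAbs_norm_of_isPrimary hw).pos.ne'
  have hz0 : z.norm.natAbs ≠ 0 := (odd_natAbs_norm_of_isPrimary hz).pos.ne'
  by_cases hprim : IsPrimitive (w * z)
  · -- `(z/w)(w/z) = (Re wz / |wz|²) = 1`
    have hprod : dirichletSym z w * dirichletSym w z = 1 := by
      rw [dirichletSym_def, dirichletSym_def, hre, ← jacobiSym.mul_right' _ hw0 hz0,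
        ← Int.natAbs_mul, ← Zsqrtd.norm_mul]
      exact jacobiSym_re_natAbs_norm hwz hprim
    rcases Int.eq_one_or_neg_one_of_mul_eq_one' hprod with ⟨h1, h2⟩ | ⟨h1, h2⟩
    · rw [h1, h2]
    · rw [h1, h2]
  · -- a prime `p ∣ wz`; it divides `|w|²`, `|z|²` and `Re wz`, so both symbols vanish
    have hg1 : Int.gcd (w * z).re (w * z).im ≠ 1 := hprim
    obtain ⟨p, hp, hpg⟩ := Nat.exists_prime_and_dvd hg1
    have hpre : (p : ℤ) ∣ (w * z).re := (Int.natCast_dvd_natCast.mpr hpg).trans (Int.gcd_dvd_left _ _)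
    have hpim : (p : ℤ) ∣ (w * z).im := (Int.natCast_dvd_natCast.mpr hpg).trans (Int.gcd_dvd_right _ _)
    have hp2 : p ≠ 2 := by
      rintro rfl
      have hodd := re_odd_of_isPrimary hwz
      omega
    have hdvd : (p : ℤ[i]) ∣ w * z := by
      rw [← Int.cast_natCast, Zsqrtd.intCast_dvd]; exact ⟨hpre, hpim⟩
    obtain ⟨hpw, hpz⟩ := natCast_dvd_norm_of_prime_dvd_mul hp hp2 hw' hz' hdvd
    have h1 : dirichletSym z w = 0 := by
      rw [dirichletSym_def]
      refine jacobiSym_eq_zero_of_prime_dvd hp hw0 hpre ?_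
      rwa [GaussianInt.abs_natCast_norm]
    have h2 : dirichletSym w z = 0 := by
      rw [dirichletSym_def, hre]
      refine jacobiSym_eq_zero_of_prime_dvd hp hz0 hpre ?_
      rwa [GaussianInt.abs_natCast_norm]
    rw [h1, h2]

/-- **Vanishing**: a common non-unit divisor of `w` and `z̄` kills the symbol,
`(w, z̄) ≠ 1 ⇒ (z / w) = 0` ("`(z/w) = 0` if and only if `(w, z̄) ≠ 1`"; this is the direction
used in the paper). [cite: FriedlanderIwaniecAnnals1998, §19 after (19.11)] -/
theorem dirichletSym_eq_zero_of_dvd {w z e : ℤ[i]} (hw : IsPrimary w) (he : ¬ IsUnit e)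
    (hew : e ∣ w) (hez : e ∣ star z) : dirichletSym z w = 0 := by
  have hw0 : w.norm.natAbs ≠ 0 := (odd_natAbs_norm_of_isPrimary hw).pos.ne'
  have he0 : e ≠ 0 := by
    rintro rfl
    exact hw.ne_zero (zero_dvd_iff.mp hew)
  -- a prime factor `π` of `e`, of norm `> 1`
  obtain ⟨π, hπirr, hπe⟩ := WfDvdMonoid.exists_irreducible_factor he he0
  have hπw : π ∣ w := hπe.trans hew
  have hπz : π ∣ star z := hπe.trans hez
  -- `N(π) ∣ N(w)` and `N(π) ∣ wz` (as `π̄ ∣ z`)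
  have hn1 : π.norm ∣ w.norm := norm_dvd_norm hπw
  have hπz' : star π ∣ z := by
    obtain ⟨c, hc⟩ := hπz
    refine ⟨star c, ?_⟩
    have : z = star (π * c) := by rw [← hc, star_star]
    rw [this, star_mul']
  have hn2 : (π.norm : ℤ[i]) ∣ w * z := by
    rw [cast_norm_eq]; exact mul_dvd_mul hπw hπz'
  rw [Zsqrtd.intCast_dvd] at hn2
  -- `N(π) > 1`
  have hN1 : 1 < π.norm.natAbs := by
    have hN0 : π.norm ≠ 0 := by
      rw [Ne, GaussianInt.norm_eq_zero]; exact hπirr.ne_zero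
    have hNne1 : π.norm.natAbs ≠ 1 := fun h => hπirr.not_isUnit (Zsqrtd.norm_eq_one_iff.mp h)
    have : π.norm.natAbs ≠ 0 := Int.natAbs_ne_zero.mpr hN0
    omega
  obtain ⟨p, hp, hpN⟩ := Nat.exists_prime_and_dvd hN1.ne'
  have hpN' : (p : ℤ) ∣ π.norm := by
    have := Int.natCast_dvd_natCast.mpr hpN
    rwa [GaussianInt.abs_natCast_norm] at this
  rw [dirichletSym_def]
  refine jacobiSym_eq_zero_of_prime_dvd hp hw0 (hpN'.trans hn2.1) ?_
  rw [GaussianInt.abs_natCast_norm]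
  exact hpN'.trans hn1

end Literature.NumberTheory.Sieve.FriedlanderIwaniecPrimes
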